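import Mathlib
/-! # Stub `stub_engineDepthOne` — crux `TwoProducts` (stmt-ValiantsHypothesis-5906), line `corner-log-linearization`
   The DEPTH-ONE CASCADE rung of the engine (n-uniform, polynomial in `t`).

   Setting: `W = ∏ u_i - ∏ v_i` for arbitrary bivariate `u_i, v_i` (no hypothesis on constant terms),
   sparsity `≤ t`.  A south-west vertex is a strict minimiser over `supp W` of a linear form with both
   weights positive.  Structure lemma (the robust form of "exposed vertices are sums of CANCELLED
   first-order points", cf. `Negative/FirstOrderExposure.lean`): write a vertex `e ∈ supp ∏ u_i` as
   `e = Σ_i a_i` with `a_i ∈ supp u_i`; if at least two `a_i` are nonzero then every nonzero `a_i` has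
   strictly smaller weight than `e`, so it is NOT in `supp W` (it is a *dead* monomial of `u_i`), and
   likewise every partial sum missing a nonzero part is strictly lighter than `e`.  Hypothesis (H)
   — "the sum of two dead nonzero monomials of two distinct factors of the same product is alive" —
   then forbids three or more nonzero parts (the two-part partial sum would be an alive point lighter
   than `e`).  Hence every south-west vertex is `0`, a monomial of some factor, or a sum of two
   monomials of two factors: at most `1 + 2nt + 2n²t² ≤ (2nt+1)²` of them.  So in the depth-one
   regime (cascades of cancellations stop after the first order) the engine holds with a polynomial
   bound; all the difficulty of the crux is in cancelled sums of cancelled monomials. [folklore] -/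
set_option linter.dupNamespace false -- single-conjunct summit: `ValiantsHypothesis.ValiantsHypothesis`
namespace Summit.ValiantsHypothesis.ValiantsHypothesis.Theorems.TwoProducts.DepthOne
open scoped BigOperators Pointwise

/-- The weight `w₀x₀ + w₁x₁` is additive over finite sums of exponents. [folklore] -/
theorem wt_sum {ι : Type*} (w : Fin 2 → ℤ) (s : Finset ι) (a : ι → (Fin 2 →₀ ℕ)) :
    w 0 * ((∑ i ∈ s, a i) 0 : ℤ) + w 1 * ((∑ i ∈ s, a i) 1 : ℤ) =
      ∑ i ∈ s, (w 0 * (a i 0 : ℤ) + w 1 * (a i 1 : ℤ)) := by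
  rw [Finsupp.finsetSum_apply, Finsupp.finsetSum_apply]
  push_cast
  rw [Finset.mul_sum, Finset.mul_sum, ← Finset.sum_add_distrib]

/-- With positive weights every exponent has nonnegative weight. [folklore] -/
theorem wt_nonneg (w : Fin 2 → ℤ) (hw0 : 0 < w 0) (hw1 : 0 < w 1) (x : Fin 2 →₀ ℕ) :
    0 ≤ w 0 * (x 0 : ℤ) + w 1 * (x 1 : ℤ) :=
  add_nonneg (mul_nonneg hw0.le (by positivity)) (mul_nonneg hw1.le (by positivity))

/-- With positive weights every nonzero exponent has positive weight. [folklore] -/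
theorem wt_pos (w : Fin 2 → ℤ) (hw0 : 0 < w 0) (hw1 : 0 < w 1) (x : Fin 2 →₀ ℕ) (hx : x ≠ 0) :
    0 < w 0 * (x 0 : ℤ) + w 1 * (x 1 : ℤ) := by
  have h : x 0 ≠ 0 ∨ x 1 ≠ 0 := by
    by_contra hcon
    push Not at hcon
    apply hx
    ext i
    fin_cases i
    · simpa using hcon.1
    · simpa using hcon.2
  rcases h with h | h
  · have h1 : (1 : ℤ) ≤ (x 0 : ℤ) := by exact_mod_cast Nat.one_le_iff_ne_zero.mpr h
    have h2 : (0 : ℤ) ≤ (x 1 : ℤ) := by positivity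
    nlinarith
  · have h1 : (1 : ℤ) ≤ (x 1 : ℤ) := by exact_mod_cast Nat.one_le_iff_ne_zero.mpr h
    have h2 : (0 : ℤ) ≤ (x 0 : ℤ) := by positivity
    nlinarith

/-- A partial sum missing a nonzero part is strictly lighter than the full sum. [folklore] -/
theorem wt_partial_lt {n : ℕ} (w : Fin 2 → ℤ) (hw0 : 0 < w 0) (hw1 : 0 < w 1)
    (a : Fin n → (Fin 2 →₀ ℕ)) (I : Finset (Fin n)) (k : Fin n) (hk : k ∉ I) (hak : a k ≠ 0) :
    w 0 * ((∑ i ∈ I, a i) 0 : ℤ) + w 1 * ((∑ i ∈ I, a i) 1 : ℤ) <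
      w 0 * ((∑ i, a i) 0 : ℤ) + w 1 * ((∑ i, a i) 1 : ℤ) := by
  classical
  have hsplit : (∑ i, a i) = (∑ i ∈ I, a i) + ∑ i ∈ Iᶜ, a i := (Finset.sum_add_sum_compl I a).symm
  have hkc : k ∈ Iᶜ := Finset.mem_compl.mpr hk
  have hrest : w 0 * ((∑ i ∈ Iᶜ, a i) 0 : ℤ) + w 1 * ((∑ i ∈ Iᶜ, a i) 1 : ℤ) ≥
      w 0 * (a k 0 : ℤ) + w 1 * (a k 1 : ℤ) := by
    rw [wt_sum]
    exact Finset.single_le_sum (fun i _ => wt_nonneg w hw0 hw1 (a i)) hkc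
  have hpos := wt_pos w hw0 hw1 (a k) hak
  rw [hsplit]
  simp only [Finsupp.coe_add, Pi.add_apply, Nat.cast_add]
  nlinarith [hrest, hpos]

/-- Every exponent of `∏ i, u i` is a sum of exponents of the factors. [folklore] -/
theorem exists_rep_of_mem_support_prod :
    ∀ (n : ℕ) (u : Fin n → MvPolynomial (Fin 2) ℂ), ∀ e ∈ (∏ i, u i).support,
      ∃ a : Fin n → (Fin 2 →₀ ℕ), (∀ i, a i ∈ (u i).support) ∧ e = ∑ i, a i := by
  classical
  intro n
  induction n with
  | zero =>
    intro u e he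
    simp only [Finset.univ_eq_empty, Finset.prod_empty] at he
    have he0 : e = 0 := by
      by_contra h
      rw [MvPolynomial.mem_support_iff, MvPolynomial.coeff_one, if_neg (Ne.symm h)] at he
      exact he rfl
    exact ⟨fun i => Fin.elim0 i, fun i => Fin.elim0 i, by simp [he0]⟩
  | succ n ih =>
    intro u e he
    rw [Fin.prod_univ_succ] at he
    obtain ⟨x, hx, y, hy, rfl⟩ := Finset.mem_add.mp (MvPolynomial.support_mul _ _ he)
    obtain ⟨a', ha', hy'⟩ := ih (fun i => u i.succ) y hy
    refine ⟨Fin.cons x a', fun i => ?_, ?_⟩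
    · refine Fin.cases ?_ (fun j => ?_) i
      · simpa using hx
      · simpa using ha' j
    · rw [Fin.sum_univ_succ]
      simp [hy']

/-- STRUCTURE LEMMA.  Let `e ∈ supp ∏ u_i` be a strict minimiser of a positive-weight form over a
set `S` containing, together with hypothesis (H) for the family `u` relative to `S`: then `e = 0`,
or `e` is a monomial of some `u_i`, or `e` is a sum of monomials of two distinct factors.  Here "dead"
means "not in `S`", and (H) says: the sum of two dead nonzero monomials of two distinct factors is in
`S`. [folklore] -/
theorem rep_le_two {n : ℕ} (u : Fin n → MvPolynomial (Fin 2) ℂ) (S : Finset (Fin 2 →₀ ℕ))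
    (hH : ∀ i j (a b : Fin 2 →₀ ℕ), i ≠ j → a ≠ 0 → b ≠ 0 → a ∈ (u i).support → b ∈ (u j).support →
      a ∉ S → b ∉ S → a + b ∈ S)
    (w : Fin 2 → ℤ) (hw0 : 0 < w 0) (hw1 : 0 < w 1) (e : Fin 2 →₀ ℕ)
    (hmin : ∀ e' ∈ S, e' ≠ e → w 0 * (e 0 : ℤ) + w 1 * (e 1 : ℤ) < w 0 * (e' 0 : ℤ) + w 1 * (e' 1 : ℤ))
    (he : e ∈ (∏ i, u i).support) :
    e = 0 ∨ (∃ i, e ∈ (u i).support) ∨ (∃ i j, i ≠ j ∧ e ∈ (u i).support + (u j).support) := by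
  classical
  obtain ⟨a, ha, rfl⟩ := exists_rep_of_mem_support_prod n u e he
  -- a lighter point of S contradicts minimality
  have noLighter : ∀ p ∈ S, ¬ (w 0 * (p 0 : ℤ) + w 1 * (p 1 : ℤ) <
      w 0 * ((∑ i, a i) 0 : ℤ) + w 1 * ((∑ i, a i) 1 : ℤ)) := by
    intro p hp hlt
    have hne : p ≠ ∑ i, a i := by
      rintro rfl
      exact lt_irrefl _ hlt
    exact lt_asymm hlt (hmin p hp hne)
  by_cases h0 : ∀ i, a i = 0
  · left
    exact Finset.sum_eq_zero fun i _ => h0 i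
  push Not at h0
  obtain ⟨i, hi⟩ := h0
  by_cases h1 : ∀ j, j ≠ i → a j = 0
  · right; left
    refine ⟨i, ?_⟩
    rw [Finset.sum_eq_single i (fun j _ hj => h1 j hj) (fun h => absurd (Finset.mem_univ i) h)]
    exact ha i
  push Not at h1
  obtain ⟨j, hji, hj⟩ := h1
  -- with two nonzero parts, each nonzero part is dead
  have dead : ∀ k l, k ≠ l → a l ≠ 0 → a k ∉ S := by
    intro k l hkl hal hkS
    apply noLighter (a k) hkS
    have := wt_partial_lt w hw0 hw1 a {k} l (by simpa using hkl.symm) hal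
    simpa using this
  by_cases h2 : ∀ k, k ≠ i → k ≠ j → a k = 0
  · right; right
    refine ⟨i, j, hji.symm, ?_⟩
    have hsum : ∑ k, a k = a i + a j := by
      rw [← Finset.add_sum_erase Finset.univ a (Finset.mem_univ i)]
      congr 1
      rw [Finset.sum_eq_single j]
      · intro k hk hkj
        exact h2 k (Finset.ne_of_mem_erase hk) hkj
      · intro h
        exact absurd (Finset.mem_erase.mpr ⟨hji, Finset.mem_univ j⟩) h
    rw [hsum]
    exact Finset.add_mem_add (ha i) (ha j)
  · exfalso
    push Not at h2
    obtain ⟨k, hki, hkj, hk⟩ := h2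
    have hiS : a i ∉ S := dead i j hji.symm hj
    have hjS : a j ∉ S := dead j i hji hi
    have hsumS : a i + a j ∈ S := hH i j (a i) (a j) hji.symm hi hj (ha i) (ha j) hiS hjS
    apply noLighter (a i + a j) hsumS
    have hkI : k ∉ ({i, j} : Finset (Fin n)) := by simp [hki, hkj]
    have := wt_partial_lt w hw0 hw1 a {i, j} k hkI hk
    rwa [Finset.sum_pair hji.symm] at this

/-- STUB `stub_engineDepthOne` (depth-one cascade rung of the engine, n-uniform and polynomial):
for `W = ∏ u_i - ∏ v_i` with `t`-sparse factors, if the sum of any two DEAD nonzero monomials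
(coefficient of `W` zero) of two distinct factors of the same product is ALIVE (coefficient of `W`
nonzero), then `W` has at most `(2nt+1)²` south-west vertices. [folklore] -/
theorem stub_engineDepthOne : ∀ (n t : ℕ) (u v : Fin n → MvPolynomial (Fin 2) ℂ), (∀ i, (u i).support.card ≤ t) → (∀ i, (v i).support.card ≤ t) → (∀ i j (a b : Fin 2 →₀ ℕ), i ≠ j → a ≠ 0 → b ≠ 0 → a ∈ (u i).support → b ∈ (u j).support → MvPolynomial.coeff a (∏ i, u i - ∏ i, v i) = 0 → MvPolynomial.coeff b (∏ i, u i - ∏ i, v i) = 0 → MvPolynomial.coeff (a + b) (∏ i, u i - ∏ i, v i) ≠ 0) → (∀ i j (a b : Fin 2 →₀ ℕ), i ≠ j → a ≠ 0 → b ≠ 0 → a ∈ (v i).support → b ∈ (v j).support → MvPolynomial.coeff a (∏ i, u i - ∏ i, v i) = 0 → MvPolynomial.coeff b (∏ i, u i - ∏ i, v i) = 0 → MvPolynomial.coeff (a + b) (∏ i, u i - ∏ i, v i) ≠ 0) → ({e : Fin 2 →₀ ℕ | ∃ w : Fin 2 → ℤ, 0 < w 0 ∧ 0 < w 1 ∧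 ((e) ∈ ((∏ i, u i - ∏ i, v i).support) ∧ ∀ e' ∈ ((∏ i, u i - ∏ i, v i).support), e' ≠ (e) → ((w) 0 * ((e) 0 : ℤ) + (w) 1 * ((e) 1 : ℤ)) < ((w) 0 * ((e') 0 : ℤ) + (w) 1 * ((e') 1 : ℤ)))}).ncard ≤ (2 * n * t + 1) ^ 2 := by
  intro n t u v hu hv hHu hHv
  classical
  set W := ∏ i, u i - ∏ i, v i with hW
  set S := W.support with hS
  -- (H) in membership form
  have hHu' : ∀ i j (a b : Fin 2 →₀ ℕ), i ≠ j → a ≠ 0 → b ≠ 0 → a ∈ (u i).support →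
      b ∈ (u j).support → a ∉ S → b ∉ S → a + b ∈ S := by
    intro i j a b hij ha hb hai hbj haS hbS
    rw [hS, MvPolynomial.mem_support_iff]
    exact hHu i j a b hij ha hb hai hbj (MvPolynomial.notMem_support_iff.mp haS)
      (MvPolynomial.notMem_support_iff.mp hbS)
  have hHv' : ∀ i j (a b : Fin 2 →₀ ℕ), i ≠ j → a ≠ 0 → b ≠ 0 → a ∈ (v i).support →
      b ∈ (v j).support → a ∉ S → b ∉ S → a + b ∈ S := by
    intro i j a b hij ha hb hai hbj haS hbS
    rw [hS, MvPolynomial.mem_support_iff]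
    exact hHv i j a b hij ha hb hai hbj (MvPolynomial.notMem_support_iff.mp haS)
      (MvPolynomial.notMem_support_iff.mp hbS)
  -- the candidate finite sets
  set F1 : Finset (Fin 2 →₀ ℕ) := (Finset.univ.biUnion fun i => (u i).support) ∪
    (Finset.univ.biUnion fun i => (v i).support) with hF1
  set F2 : Finset (Fin 2 →₀ ℕ) :=
    ((Finset.univ : Finset (Fin n × Fin n)).biUnion fun p => (u p.1).support + (u p.2).support) ∪
    ((Finset.univ : Finset (Fin n × Fin n)).biUnion fun p => (v p.1).support + (v p.2).support) with hF2
  set G : Finset (Fin 2 →₀ ℕ) := insert 0 (F1 ∪ F2) with hG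
  set SW := {e : Fin 2 →₀ ℕ | ∃ w : Fin 2 → ℤ, 0 < w 0 ∧ 0 < w 1 ∧ (e ∈ S ∧ ∀ e' ∈ S, e' ≠ e →
      w 0 * (e 0 : ℤ) + w 1 * (e 1 : ℤ) < w 0 * (e' 0 : ℤ) + w 1 * (e' 1 : ℤ))} with hSW
  have hsub : SW ⊆ ↑G := by
    rintro e ⟨w, hw0, hw1, he, hmin⟩
    rw [Finset.mem_coe, hG, Finset.mem_insert, Finset.mem_union]
    rcases Finset.mem_union.mp (MvPolynomial.support_sub _ _ _ he) with h | h
    · rcases rep_le_two u S hHu' w hw0 hw1 e hmin h with h0 | ⟨i, hi⟩ | ⟨i, j, -, hij⟩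
      · exact Or.inl h0
      · refine Or.inr (Or.inl ?_)
        rw [hF1, Finset.mem_union, Finset.mem_biUnion]
        exact Or.inl ⟨i, Finset.mem_univ i, hi⟩
      · refine Or.inr (Or.inr ?_)
        rw [hF2, Finset.mem_union, Finset.mem_biUnion]
        exact Or.inl ⟨(i, j), Finset.mem_univ _, hij⟩
    · rcases rep_le_two v S hHv' w hw0 hw1 e hmin h with h0 | ⟨i, hi⟩ | ⟨i, j, -, hij⟩
      · exact Or.inl h0
      · refine Or.inr (Or.inl ?_)
        rw [hF1, Finset.mem_union, Finset.mem_biUnion, Finset.mem_biUnion]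
        exact Or.inr ⟨i, Finset.mem_univ i, hi⟩
      · refine Or.inr (Or.inr ?_)
        rw [hF2, Finset.mem_union, Finset.mem_biUnion, Finset.mem_biUnion]
        exact Or.inr ⟨(i, j), Finset.mem_univ _, hij⟩
  -- cardinalities
  have hF1card : F1.card ≤ n * t + n * t := by
    rw [hF1]
    refine (Finset.card_union_le _ _).trans (Nat.add_le_add ?_ ?_)
    · calc (Finset.univ.biUnion fun i => (u i).support).card ≤ Finset.univ.card * t :=
            Finset.card_biUnion_le_card_mul _ _ _ fun i _ => hu i
        _ = n * t := by rw [Finset.card_univ, Fintype.card_fin]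
    · calc (Finset.univ.biUnion fun i => (v i).support).card ≤ Finset.univ.card * t :=
            Finset.card_biUnion_le_card_mul _ _ _ fun i _ => hv i
        _ = n * t := by rw [Finset.card_univ, Fintype.card_fin]
  have hF2card : F2.card ≤ n * n * (t * t) + n * n * (t * t) := by
    rw [hF2]
    refine (Finset.card_union_le _ _).trans (Nat.add_le_add ?_ ?_)
    · calc ((Finset.univ : Finset (Fin n × Fin n)).biUnion
              fun p => (u p.1).support + (u p.2).support).card
            ≤ (Finset.univ : Finset (Fin n × Fin n)).card * (t * t) :=
            Finset.card_biUnion_le_card_mul _ _ _ fun p _ =>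
              Finset.card_add_le.trans (Nat.mul_le_mul (hu p.1) (hu p.2))
        _ = n * n * (t * t) := by rw [Finset.card_univ, Fintype.card_prod, Fintype.card_fin]
    · calc ((Finset.univ : Finset (Fin n × Fin n)).biUnion
              fun p => (v p.1).support + (v p.2).support).card
            ≤ (Finset.univ : Finset (Fin n × Fin n)).card * (t * t) :=
            Finset.card_biUnion_le_card_mul _ _ _ fun p _ =>
              Finset.card_add_le.trans (Nat.mul_le_mul (hv p.1) (hv p.2))
        _ = n * n * (t * t) := by rw [Finset.card_univ, Fintype.card_prod, Fintype.card_fin]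
  have hGcard : G.card ≤ 1 + (n * t + n * t) + (n * n * (t * t) + n * n * (t * t)) := by
    rw [hG]
    calc (insert 0 (F1 ∪ F2)).card ≤ (F1 ∪ F2).card + 1 := Finset.card_insert_le _ _
      _ ≤ (F1.card + F2.card) + 1 := Nat.add_le_add_right (Finset.card_union_le _ _) 1
      _ ≤ _ := by omega
  have hfin : SW.Finite := G.finite_toSet.subset hsub
  calc SW.ncard ≤ (↑G : Set (Fin 2 →₀ ℕ)).ncard := Set.ncard_le_ncard hsub G.finite_toSet
    _ = G.card := Set.ncard_coe_finset G
    _ ≤ 1 + (n * t + n * t) + (n * n * (t * t) + n * n * (t * t)) := hGcard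
    _ ≤ (2 * n * t + 1) ^ 2 := by
        have hm : 0 ≤ n * t := Nat.zero_le _
        nlinarith [hm]

end Summit.ValiantsHypothesis.ValiantsHypothesis.Theorems.TwoProducts.DepthOne
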